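import Literature.Topology.FourManifolds.SeifertSurfaceOrientation
import Literature.Topology.FourManifolds.SeifertCircleMapProofs
import Literature.Topology.FourManifolds.SurfaceGenusParityProofs
import Literature.Topology.FourManifolds.SliceGenusDiscMorseProofs
import Literature.Topology.FourManifolds.HCobordismIndexZeroOneProofs
import Literature.Topology.FourManifolds.HCobordismFirstCancellationProofs
import Literature.Topology.FourManifolds.HCobordismTheoremProofs
import Literature.Topology.FourManifolds.SPC4HandlesCancelStepProofs
import Literature.Topology.FourManifolds.DisjointSpheresSlab
import Literature.Topology.FourManifolds.MilnorChartIndexOne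
import Literature.Analysis.Calculus.SardProofs
import HarnessLib

/-!
# `g₄(K) = 0 ↔ K` is smoothly slice — reduction to Milnor's cancellation model chart

Sibling proof file of `Literature/Topology/FourManifolds/SliceGenus.lean` for its named fact
`Literature.Topology.FourManifolds.Knot.sliceGenus_eq_zero_iff` (R. H. Fox, *A quick trip
through knot theory* (1962); C. Livingston, *A survey of classical knot concordance* (2005),
§2: "a knot is slice iff its 4-ball genus vanishes").  The tree's assembly
`Knot.sliceGenus_eq_zero_iff_of_glue` (`SeifertSurfaceOrientation.lean`) proves the fact from
six leaves; five of them are now theorems of the tree: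

* `Knot.exists_circleMap_eq_angle_of_hasFraming_zero_holds` (`SeifertCircleMapProofs.lean`) —
  the circle-valued map of a framed knot complement (Rolfsen, *Knots and Links*, §5.D);
* `Literature.Analysis.Calculus.sard_holds` (`SardProofs.lean`) — Sard's theorem;
* `even_finrank_singularHomology_one_of_boundary_circle_holds` (`SurfaceGenusParityProofs.lean`)
  — the first Betti number of a compact orientable surface with one boundary circle is even
  (Hirsch, *Differential Topology*, Ch. 9 §3, Thm. 3.7);
* `morseEuler_of_isMorseAdapted_holds` (`SliceGenusDiscMorseProofs.lean`) — the Morse count of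
  the Euler characteristic (Milnor, *Morse theory*, §5);
* the two Morse-cancellation leaves `Cobordism.Milnor1965_cancel_index_zero` (Milnor, *Lectures
  on the h-cobordism theorem* (1965), Thm. 8.1) and
  `exists_isMorseAdapted_ncard_criticalSetOfIndex_zero_add_one_eq 1`, both of which the tree
  reduces (`Cobordism.Milnor1965_cancel_index_zero_of_facts`,
  `Cobordism.Milnor1965_firstCancellation_slab_of_modelChart`,
  `exists_isMorseAdapted_ncard_criticalSetOfIndex_zero_add_one_eq_of_firstCancellation`,
  with `Cobordism.Milnor1965_finalRearrangement_holds` and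
  `Cobordism.Milnor1965_localStructure_index_one_holds`) to the single remaining named fact
  `Cobordism.Milnor1965_cancellation_modelChart` (Milnor 1965, proof of Thm. 5.4, Assertion 6;
  `HCobordismPreliminaryHypothesis.lean`).

This file records the resulting one-hypothesis reductions
`Knot.sliceGenus_eq_zero_iff_of_modelChart` — **`Knot.sliceGenus_eq_zero_iff` follows from
`Cobordism.Milnor1965_cancellation_modelChart` alone** — and, one step deeper along the tree's
`Cobordism.Milnor1965_cancellation_modelChart_of_levelDeformation` (`HCobordismTheoremProofs.lean`),
`Knot.sliceGenus_eq_zero_iff_of_levelDeformation` (hypothesis: the deformation of the level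
diffeomorphism `h`, Milnor 1965, proof of Thm. 5.4, Assertion 6, general case;
`Cobordism.Milnor1965_cancellation_levelDeformation`, `HCobordismLevelIsotopy.lean`).  No named
facts are introduced.

**Discharge.**  That last leaf is now a theorem of the tree
(`Cobordism.Milnor1965_cancellation_levelDeformation_holds`, `HCobordismLevelDeformationProof.lean`;
whence `Cobordism.Milnor1965_cancellation_modelChart_holds`, `HCobordismTheoremProofs.lean`), so
the named fact is discharged outright: `Knot.sliceGenus_eq_zero_iff_holds`.

## References

* R. H. Fox, *A quick trip through knot theory*, in: Topology of 3-manifolds (1962). [Fox1962]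
* C. Livingston, *A survey of classical knot concordance*, Handbook of Knot Theory (2005), §2.
  [Livingston2005]
* J. Milnor, *Lectures on the h-cobordism theorem*, Princeton (1965), Thm. 5.4 (Assertion 6),
  Thm. 8.1. [MilnorHCobordism1965]
* M. W. Hirsch, *Differential Topology*, GTM 33 (1976), Ch. 9 §3, Thm. 3.7. [HirschDT1976]
-/

noncomputable section

namespace Literature.Topology.FourManifolds

/-- **`g₄(K) = 0 ↔ K` is smoothly slice, granted Milnor's cancellation model chart** (Fox 1962;
Livingston 2005, §2): the assembly `Knot.sliceGenus_eq_zero_iff_of_glue` fed with the tree's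
discharged leaves — the framed circle map (`Knot.exists_circleMap_eq_angle_of_hasFraming_zero_holds`),
Sard's theorem (`sard_holds`), the parity of `b₁` of a Seifert surface
(`even_finrank_singularHomology_one_of_boundary_circle_holds`), the Morse–Euler count
(`morseEuler_of_isMorseAdapted_holds`) — and with the two Morse-cancellation leaves reduced to
`Cobordism.Milnor1965_cancellation_modelChart` (Milnor 1965, proof of Thm. 5.4).
[cite: Fox1962] [cite: MilnorHCobordism1965, Thm. 5.4 (Assertion 6) and Thm. 8.1] -/
theorem Knot.sliceGenus_eq_zero_iff_of_modelChart
    (hE : Cobordism.Milnor1965_cancellation_modelChart.{0}) : Knot.sliceGenus_eq_zero_iff :=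
  Knot.sliceGenus_eq_zero_iff_of_glue Knot.exists_circleMap_eq_angle_of_hasFraming_zero_holds
    Literature.Analysis.Calculus.sard_holds even_finrank_singularHomology_one_of_boundary_circle_holds
    (Cobordism.Milnor1965_cancel_index_zero_of_facts Cobordism.Milnor1965_finalRearrangement_holds
      (Cobordism.Milnor1965_firstCancellation_slab_of_modelChart hE)
      Cobordism.Milnor1965_localStructure_index_one_holds)
    (exists_isMorseAdapted_ncard_criticalSetOfIndex_zero_add_one_eq_of_firstCancellation 1
      (Cobordism.Milnor1965_firstCancellation_slab_of_modelChart hE))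
    morseEuler_of_isMorseAdapted_holds

/-- **`g₄(K) = 0 ↔ K` is smoothly slice, granted the deformation of the level diffeomorphism**
of Milnor's proof of Thm. 5.4 (Assertion 6, the general case, PDF pp. 31–32; the named fact
`Cobordism.Milnor1965_cancellation_levelDeformation`, `HCobordismLevelIsotopy.lean`), through
the tree's `Cobordism.Milnor1965_cancellation_modelChart_of_levelDeformation`
(`HCobordismTheoremProofs.lean`) and `Knot.sliceGenus_eq_zero_iff_of_modelChart`: this is the
deepest currently undischarged leaf below `Knot.sliceGenus_eq_zero_iff`.
[cite: Fox1962] [cite: MilnorHCobordism1965, proof of Thm. 5.4, Assertion 6 (PDF pp. 31–32)] -/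
theorem Knot.sliceGenus_eq_zero_iff_of_levelDeformation
    (hD : Cobordism.Milnor1965_cancellation_levelDeformation.{0}) : Knot.sliceGenus_eq_zero_iff :=
  Knot.sliceGenus_eq_zero_iff_of_modelChart
    (Cobordism.Milnor1965_cancellation_modelChart_of_levelDeformation hD)

/-- **`g₄(K) = 0 ↔ K` is smoothly slice** (Fox 1962, §7; Livingston 2005, §2: a knot is slice
iff its `4`-ball genus vanishes) — discharge of the named fact
`Literature.Topology.FourManifolds.Knot.sliceGenus_eq_zero_iff` of `SliceGenus.lean`:
`Knot.sliceGenus_eq_zero_iff_of_modelChart` applied to the tree's discharge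
`Cobordism.Milnor1965_cancellation_modelChart_holds` (`HCobordismTheoremProofs.lean`; Milnor 1965,
proof of Thm. 5.4, Assertion 6, from `Cobordism.Milnor1965_cancellation_levelDeformation_holds`).
The proof thus runs: a genus-`0` slice surface is a disc (Seifert surface via the framed circle
map and Sard, parity of `b₁`, Morse–Euler count and Milnor's cancellation of the index-`0`/`1`
critical points, classification of the genus-`0` surface with one boundary circle), isotoped rel
boundary to a neat slice disc; conversely a neat slice disc is a genus-`0` slice surface.
[cite: Fox1962, §7] [cite: Livingston2005, §2]
[cite: MilnorHCobordism1965, Thm. 5.4 (Assertion 6) and Thm. 8.1] -/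
theorem Knot.sliceGenus_eq_zero_iff_holds : Knot.sliceGenus_eq_zero_iff :=
  Knot.sliceGenus_eq_zero_iff_of_modelChart Cobordism.Milnor1965_cancellation_modelChart_holds

end Literature.Topology.FourManifolds
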